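import Summits.CriticalPhenomena.PercolationContinuityZ3.Theorems.PercNearOneGluingNoHeavyLowerTailSunflowerTBernEndgame
import HarnessLib

/-!
# `NoHeavyLowerTail` (crux stmt-CriticalPhenomena-4575), abstract sunflower cubic: T-BERN — the h-endgame ★ from the scalar
# condition (HC), and (HC) for one exact dwarf

Support file (seat `prim-ineq-prove-1` gen 63; `--supports stmt-CriticalPhenomena-4575`).  No `sorry`, no named facts.
Memo: run/shared/lean/prim/prim-ineq-prove-1/FINDING-CONVEX-prove1-g63.md §5.1.

★ is the last step of the sequential scheme (normalised): a state `(A, G)` (the hub with the pack absorbed exactly; `A ≤ ᾱ`) meets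
the h-petal `(1, γ_h)`, `γ_h = 1 + μζ`, under the g-budget `Gγ_h ≤ Y` and the z-structure `γ_D z_P (1+ζ) ≤ Y` (`Y = γ_D Z`,
`Z ≥ z_P z_h`), and must satisfy `Aγ_h + G ≤ ᾱ + Y`.  **`star_of_hc`**: this holds as soon as `ᾱμ ≤ γ_D z_P` (the identity (I1) of the
memo, `ᾱμ = (1−κ)γ_D`) and, in the only nontrivial case `γ_D z_P < G < A`,
  **(HC)**  `μ(A − G)(G − γ_D z_P) ≤ (ᾱ − A)(γ_D z_P − μG)`
— a condition on {hub, pack} alone (no h, no Z, no Y): take the convex combination of the two lower bounds for `Y` with weight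
`s = μ(A−G)/(γ_D z_P − μG)` on the z-bound.  **`hc_one_dwarf`**: (HC) for the state of a hub `(x_P, z_P, w_P)` that absorbed ONE exact
dwarf (`A = α_Pγ_D − γ_P(γ_D−α_D) ≤ ᾱ − γ_Pδ`, `G = γ_Pγ_D`, `γ_P ∈ [z_P, γ_D z_P]`): it is the nonnegativity of the convex quadratic
`μγ_D t² − c t + λδ z_P²`, `t = γ_P − z_P ∈ [0, (γ_D−1)z_P]`, `c = (λ−κ)z_P − (1−κ)γ_D(z_P−1)`, shown by "vertex outside ⇒ endpoint" /
"vertex inside ⇒ discriminant" (at the right endpoint the value is `z_P[μγ_D(γ_D−1)²z_P + (1−κ)γ_D(γ_D−1)(z_P−1)]`).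
Numerically (HC) holds for every hub and every pack (memo §5.1, hcn.py); its general proof is the open item.
-/

noncomputable section

namespace Summit.CriticalPhenomena.PercolationContinuityZ3.Theorems.SunflowerPartition

namespace SafeCalc

namespace LinkedCurrency

/-- **★ from (HC).**  See the module docstring (`gz` stands for `γ_D·z_P`). [this work] -/
theorem star_of_hc {A G gz ζ μ abar Y : ℝ} (hμ : 0 ≤ μ) (hζ : 0 ≤ ζ) (hgz : 0 < gz)
    (hA : A ≤ abar) (hbud : G * (1 + μ * ζ) ≤ Y) (hz : gz * (1 + ζ) ≤ Y) (hI : abar * μ ≤ gz)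
    (hHC : gz < G → G < A → μ * (A - G) * (G - gz) ≤ (abar - A) * (gz - μ * G)) :
    A * (1 + μ * ζ) + G ≤ abar + Y := by
  rcases le_or_gt A G with hAG | hAG
  · -- aligned state
    have h1 : A * (μ * ζ) ≤ G * (μ * ζ) := mul_le_mul_of_nonneg_right hAG (mul_nonneg hμ hζ)
    nlinarith
  rcases le_or_gt G gz with hGz | hGz
  · -- the state's γ is below the z-saturated level: z-structure pays
    have h1 : A * (μ * ζ) ≤ abar * (μ * ζ) := mul_le_mul_of_nonneg_right hA (mul_nonneg hμ hζ)
    have h2 : abar * (μ * ζ) ≤ gz * ζ := by nlinarith [mul_le_mul_of_nonneg_right hI hζ]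
    nlinarith
  · -- the hard case: convex combination with weight `s`
    have hHC' := hHC hGz hAG
    have hμA : μ * A ≤ gz := by nlinarith [mul_le_mul_of_nonneg_right hA hμ]
    have hden : 0 < gz - μ * G := by
      rcases eq_or_lt_of_le hμ with hμ0 | hμpos
      · rw [← hμ0]; linarith
      · nlinarith [mul_lt_mul_of_pos_left hAG hμpos]
    obtain ⟨s, hs⟩ : ∃ s : ℝ, s = μ * (A - G) / (gz - μ * G) := ⟨_, rfl⟩
    have hs0 : 0 ≤ s := by rw [hs]; exact div_nonneg (mul_nonneg hμ (sub_nonneg.2 hAG.le)) hden.le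
    have hsden : s * (gz - μ * G) = μ * (A - G) := by rw [hs]; exact div_mul_cancel₀ _ hden.ne'
    have hs1 : s ≤ 1 := by
      rw [hs, div_le_one hden]
      linarith [hμA]
    -- s (G − gz) ≤ abar − A, from (HC)
    have hsR : s * (G - gz) ≤ abar - A := by
      have h1 : s * (G - gz) * (gz - μ * G) = μ * (A - G) * (G - gz) := by
        rw [show s * (G - gz) * (gz - μ * G) = (s * (gz - μ * G)) * (G - gz) by ring, hsden]
      have h2 : s * (G - gz) * (gz - μ * G) ≤ (abar - A) * (gz - μ * G) := by rw [h1]; exact hHC'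
      exact le_of_mul_le_mul_right h2 hden
    -- Y ≥ (1−s)·G(1+μζ) + s·gz(1+ζ)
    have hY : (1 - s) * (G * (1 + μ * ζ)) + s * (gz * (1 + ζ)) ≤ Y := by
      have h1 := mul_le_mul_of_nonneg_left hbud (sub_nonneg.2 hs1)
      have h2 := mul_le_mul_of_nonneg_left hz hs0
      linarith
    -- ζ-terms cancel by the choice of s; constants by hsR
    have hAμ : A * μ = (1 - s) * (G * μ) + s * gz := by linear_combination -hsden
    have hfinal : abar + Y - (A * (1 + μ * ζ) + G) =
        (abar - A - s * (G - gz)) + (Y - ((1 - s) * (G * (1 + μ * ζ)) + s * (gz * (1 + ζ)))) +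
          ζ * ((1 - s) * (G * μ) + s * gz - A * μ) := by ring
    rw [← sub_nonneg, hfinal, hAμ]
    have e0 : ζ * ((1 - s) * (G * μ) + s * gz - ((1 - s) * (G * μ) + s * gz)) = 0 := by ring
    rw [e0, add_zero]
    exact add_nonneg (by linarith) (by linarith)

/-- **(HC) for one exact dwarf.**  Parameters: `0 ≤ κ ≤ λ ≤ 1`, `μ = 1−λ`, `D ≥ 1`, `γ_D = λD + μ`, `α_D = 1 + κ(D−1)`,
`δ = γ_D − α_D`, `ᾱμ = (1−κ)γ_D`.  For `z_P ≥ 1` and `γ_P ∈ [z_P, γ_D z_P]`: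
`μ(ᾱ − γ_P(δ + γ_D))(γ_P − z_P) ≤ γ_Pδ(z_P − μγ_P)`.  (With `A ≤ ᾱ − γ_Pδ`, `G = γ_Pγ_D` this gives (HC) after dividing by `γ_D`.)
[this work] -/
theorem hc_one_dwarf {κ lam μ D abar zP g : ℝ} (hκ0 : 0 ≤ κ) (hκl : κ ≤ lam) (hl1 : lam ≤ 1) (hμ : μ = 1 - lam)
    (hD : 1 ≤ D) (habar : abar * μ = (1 - κ) * (lam * D + μ)) (hzP : 1 ≤ zP) (hg1 : zP ≤ g)
    (hg2 : g ≤ (lam * D + μ) * zP) :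
    μ * (abar - g * (((lam * D + μ) - (1 + κ * (D - 1))) + (lam * D + μ))) * (g - zP) ≤
      g * ((lam * D + μ) - (1 + κ * (D - 1))) * (zP - μ * g) := by
  -- names
  set γD : ℝ := lam * D + μ with hγD
  set δ : ℝ := γD - (1 + κ * (D - 1)) with hδ
  have hμ0 : 0 ≤ μ := by rw [hμ]; linarith
  have hlk : 0 ≤ lam - κ := sub_nonneg.2 hκl
  have hD' : 0 ≤ D - 1 := sub_nonneg.2 hD
  have hδe : δ = (lam - κ) * (D - 1) := by rw [hδ, hγD, hμ]; ring
  have hδ0 : 0 ≤ δ := by rw [hδe]; exact mul_nonneg hlk hD'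
  have hγD1 : γD - 1 = lam * (D - 1) := by rw [hγD, hμ]; ring
  have hγD1' : 0 ≤ γD - 1 := by rw [hγD1]; exact mul_nonneg (hκ0.trans hκl) hD'
  have hγD0 : 0 < γD := by linarith
  -- the quadratic in t = g − zP
  set t : ℝ := g - zP with ht
  set T : ℝ := (γD - 1) * zP with hT
  set a : ℝ := μ * γD with ha
  set c : ℝ := (lam - κ) * zP - (1 - κ) * γD * (zP - 1) with hc
  set b' : ℝ := lam * δ * zP ^ 2 with hb'
  have ht0 : 0 ≤ t := by rw [ht]; linarith
  have htT : t ≤ T := by rw [ht, hT]; nlinarith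
  have ha0 : 0 ≤ a := mul_nonneg hμ0 hγD0.le
  have hb0 : 0 ≤ b' := by rw [hb']; exact mul_nonneg (mul_nonneg (hκ0.trans hκl) hδ0) (sq_nonneg _)
  -- the claim is `0 ≤ a t² − c t + b'`
  have key : g * δ * (zP - μ * g) - μ * (abar - g * (δ + γD)) * t = a * t ^ 2 - c * t + b' := by
    have e1 : μ * (abar - g * (δ + γD)) * t = (abar * μ) * t - μ * g * (δ + γD) * t := by ring
    rw [e1, habar, ht, ha, hc, hb', hδe, hγD, hμ]
    ring
  suffices hq : 0 ≤ a * t ^ 2 - c * t + b' by linarith [key]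
  clear key
  clear_value t T a c b' δ γD
  -- value at the right endpoint: a T² − c T + b' = zP (μ γD (γD−1)² zP + (1−κ) γD (γD−1)(zP−1)) ≥ 0
  have hend : a * T ^ 2 - c * T + b' = zP * (μ * γD * (γD - 1) ^ 2 * zP + (1 - κ) * γD * (γD - 1) * (zP - 1)) := by
    rw [ha, hT, hc, hb', hδe, hγD1]; ring
  have hend0 : 0 ≤ a * T ^ 2 - c * T + b' := by
    rw [hend]
    refine mul_nonneg (by linarith) (add_nonneg ?_ ?_)
    · exact mul_nonneg (mul_nonneg (mul_nonneg hμ0 hγD0.le) (sq_nonneg _)) (by linarith)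
    · exact mul_nonneg (mul_nonneg (mul_nonneg (by linarith) hγD0.le) hγD1') (by linarith)
  rcases le_or_gt c 0 with hc0 | hc0
  · -- c ≤ 0: every term is nonnegative
    nlinarith [mul_nonneg ha0 (sq_nonneg t), mul_nonneg (neg_nonneg.2 hc0) ht0]
  rcases le_or_gt (2 * a * T) c with hvert | hvert
  · -- vertex beyond T: the quadratic decreases on [0, T], so its value is ≥ the value at T
    have h1 : (a * t ^ 2 - c * t + b') - (a * T ^ 2 - c * T + b') = (t - T) * (a * (t + T) - c) := by ring
    have h3 : a * t ≤ a * T := mul_le_mul_of_nonneg_left htT ha0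
    have h2 : 0 ≤ (t - T) * (a * (t + T) - c) :=
      mul_nonneg_of_nonpos_of_nonpos (sub_nonpos.2 htT) (by linarith)
    linarith
  · -- vertex inside: discriminant c² ≤ 4ab' since c ≤ (λ−κ)zP and c < 2aT = 2μγD·λ(D−1)zP
    have hcle : c ≤ (lam - κ) * zP := by
      have h1 : 0 ≤ (1 - κ) * γD * (zP - 1) :=
        mul_nonneg (mul_nonneg (by linarith [(hκ0.trans hκl).trans hl1]) hγD0.le) (by linarith)
      rw [hc]; linarith
    have hapos : 0 < a := by
      by_contra h
      have ha00 : a = 0 := le_antisymm (not_lt.1 h) ha0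
      rw [ha00] at hvert; linarith
    have hdisc : c ^ 2 ≤ 4 * a * b' := by
      have h1 : c * c ≤ c * ((lam - κ) * zP) := mul_le_mul_of_nonneg_left hcle hc0.le
      have h2 : c * ((lam - κ) * zP) ≤ 2 * a * T * ((lam - κ) * zP) :=
        mul_le_mul_of_nonneg_right hvert.le (mul_nonneg hlk (by linarith))
      have h3 : 2 * a * T * ((lam - κ) * zP) = 2 * a * b' := by rw [hT, hb', hδe, hγD1]; ring
      have h4 : 0 ≤ 2 * a * b' := by positivity
      nlinarith
    -- 4a·(a t² − c t + b') = (2 a t − c)² + (4 a b' − c²) ≥ 0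
    have h4 : 4 * a * (a * t ^ 2 - c * t + b') = (2 * a * t - c) ^ 2 + (4 * a * b' - c ^ 2) := by ring
    have h5 : 0 ≤ 4 * a * (a * t ^ 2 - c * t + b') := by rw [h4]; nlinarith [sq_nonneg (2 * a * t - c)]
    by_contra hneg
    have : 4 * a * (a * t ^ 2 - c * t + b') < 0 := mul_neg_of_pos_of_neg (by linarith) (not_le.1 hneg)
    linarith

end LinkedCurrency

end SafeCalc

end Summit.CriticalPhenomena.PercolationContinuityZ3.Theorems.SunflowerPartition
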